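import Literature.Geometry.Symplectic.SphereFamilyTwoChartGluing
import HarnessLib

/-!
# The glued family of spheres: `J`-holomorphic leaves, joint smoothness, effectiveness

Sequel to `SphereFamilyTwoChartGluing.lean` (layer B6, manifold packaging, of the analytic core
of the Hofer–Lizan–Sikorav local foliation theorem; C. Wendl, *Holomorphic Curves in Low
Dimensions* (2018), Thm. 2.46 / Prop. 2.53; lead of crux `WitnessCharge`, summit
`SmoothPoincare4`). For the glued two-chart family `(U a, V a)`, `|a| < ε`, built from a family
of solutions of the chart Cauchy–Riemann equations `crExpr 𝒥.Jᵢ (𝒥.vmapᵢ (Ξᵢ a) (Φᵢ a)) = 0`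
on the discs of radius `2` (`𝒥 : SphereACData` the chart data of `JX` through the product charts
`prodChart i ι` of a `C^∞` immersion `ι : ℂℙ¹ × ℂ → X⁴`, `hint₀`, `hint₁`), we prove:

* `isJHolomorphicAt_congr_of_eventuallyEq`, `isJHolomorphicAt_comp_of_differentiableAt` — the
  pointwise `J`-holomorphicity condition `du_z (iζ) = J du_z ζ` is local in `u` and invariant
  under holomorphic reparametrisation of the source (pointwise form of
  `IsJHolomorphic.comp_of_differentiable`, used with the inversion `w = z⁻¹`);
* `isJHolomorphicAt_prodChart_vmap₀`, `isJHolomorphicAt_prodChart_vmap₁` — the chart models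
  `prodChart i ι ∘ vmapᵢ ξ f` are `JX`-holomorphic where `crExpr 𝒥.Jᵢ (vmapᵢ ξ f) = 0`
  (`crExpr_eq_zero_iff` and the transfer `isJHolomorphicAt_prodChart_comp_iff`);
* `isJHolomorphic_glueU_glueV` — **every leaf `U a`, `V a` is `JX`-holomorphic**;
* `contMDiffOn_glueU_glueV` — **the family is jointly `C^∞` on `B_ε × ℂ`** in both charts;
* `fderiv_comp_glueU_zero_ne_zero` — **effectiveness at the linearised normal level**: if `πN`
  is a submersion on an open `N ⊇ range u₀` vanishing on `range u₀` (`u₀ z = prodChart 0 ι (z, 0)`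
  the central leaf) and `Φ₀ a 0 = a`, then `d/da|₀ πN (U a 0) c ≠ 0` for `c ≠ 0`.

## References

* C. Wendl, *Holomorphic Curves in Low Dimensions*, LNM 2216 (2018), §2.3, Thm. 2.46, Prop. 2.53.
  [Wendl2018]
* C. Hummel, *Gromov's Compactness Theorem for Pseudo-holomorphic Curves* (1997), Ch. I §3,
  eq. (3.1). [Hummel1997]
-/

noncomputable section

open scoped Manifold ContDiff Topology
open Set Function Filter
open Literature.Topology.FourManifolds Literature.Topology.FourManifolds.ComplexProjectiveSpace
  Literature.Analysis.Complex.ProjectiveLineExpChart Literature.Geometry.Symplectic.CRExpression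

namespace Literature.Geometry.Symplectic

namespace SphereCR

variable {X : Type*} [TopologicalSpace X] [ChartedSpace (EuclideanSpace ℝ (Fin 4)) X]

/-! ### `J`-holomorphicity at a point: locality and holomorphic reparametrisation -/

section JHolAt

variable [IsManifold (𝓡 4) ∞ X] {JX : AlmostComplexStructure (𝓡 4) ∞ X}
  {ι : ComplexProjectiveSpace 1 × ℂ → X} {𝒥 : SphereACData}

/-- `J`-holomorphicity at a point is a local condition: it transfers along `u =ᶠ[𝓝 z] u'`.
[folklore] -/
theorem isJHolomorphicAt_congr_of_eventuallyEq {u u' : ℂ → X} {z : ℂ} (h : u =ᶠ[𝓝 z] u')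
    (hJ : ∀ ζ : ℂ, mfderiv 𝓘(ℝ, ℂ) (𝓡 4) u' z (Complex.I * ζ) =
      JX (u' z) (mfderiv 𝓘(ℝ, ℂ) (𝓡 4) u' z ζ)) (ζ : ℂ) :
    mfderiv 𝓘(ℝ, ℂ) (𝓡 4) u z (Complex.I * ζ) = JX (u z) (mfderiv 𝓘(ℝ, ℂ) (𝓡 4) u z ζ) := by
  rw [h.mfderiv_eq, h.eq_of_nhds]
  exact hJ ζ

/-- **`J`-holomorphicity at a point is invariant under holomorphic reparametrisation of the
source** (pointwise form of `IsJHolomorphic.comp_of_differentiable`): if `g` is complex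
differentiable at `z`, `u` is differentiable at `g z` and `du_{g z} ∘ i = J ∘ du_{g z}`, then
`d(u ∘ g)_z ∘ i = J ∘ d(u ∘ g)_z`. [cite: Hummel1997, Ch. I §3, Definition and eq. (3.1)] -/
theorem isJHolomorphicAt_comp_of_differentiableAt {u : ℂ → X} {g : ℂ → ℂ} {z : ℂ}
    (hg : DifferentiableAt ℂ g z) (hu : MDifferentiableAt 𝓘(ℝ, ℂ) (𝓡 4) u (g z))
    (hJ : ∀ ζ : ℂ, mfderiv 𝓘(ℝ, ℂ) (𝓡 4) u (g z) (Complex.I * ζ) =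
      JX (u (g z)) (mfderiv 𝓘(ℝ, ℂ) (𝓡 4) u (g z) ζ)) (ζ : ℂ) :
    mfderiv 𝓘(ℝ, ℂ) (𝓡 4) (u ∘ g) z (Complex.I * ζ) =
      JX ((u ∘ g) z) (mfderiv 𝓘(ℝ, ℂ) (𝓡 4) (u ∘ g) z ζ) := by
  have hg' : HasMFDerivAt 𝓘(ℝ, ℂ) 𝓘(ℝ, ℂ) g z ((fderiv ℂ g z).restrictScalars ℝ) :=
    (hg.hasFDerivAt.restrictScalars ℝ).hasMFDerivAt
  rw [(hu.hasMFDerivAt.comp z hg').mfderiv]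
  have e1 : ((fderiv ℂ g z).restrictScalars ℝ) (Complex.I * ζ) = Complex.I * fderiv ℂ g z ζ := by
    simp only [ContinuousLinearMap.coe_restrictScalars']
    rw [← smul_eq_mul, ContinuousLinearMap.map_smul, smul_eq_mul]
  calc ((mfderiv 𝓘(ℝ, ℂ) (𝓡 4) u (g z)).comp ((fderiv ℂ g z).restrictScalars ℝ)) (Complex.I * ζ)
        = mfderiv 𝓘(ℝ, ℂ) (𝓡 4) u (g z) (Complex.I * fderiv ℂ g z ζ) :=
          congrArg (mfderiv 𝓘(ℝ, ℂ) (𝓡 4) u (g z)) e1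
    _ = JX (u (g z)) (mfderiv 𝓘(ℝ, ℂ) (𝓡 4) u (g z) (fderiv ℂ g z ζ)) := hJ _
    _ = JX ((u ∘ g) z)
          (((mfderiv 𝓘(ℝ, ℂ) (𝓡 4) u (g z)).comp ((fderiv ℂ g z).restrictScalars ℝ)) ζ) := rfl

/-- **The chart-`0` model is `JX`-holomorphic where the Cauchy–Riemann expression vanishes**:
if `crExpr 𝒥.J₀ (vmap₀ ξ f) z = 0` (and `vmap₀ ξ f` is differentiable at `z`), then
`prodChart 0 ι ∘ vmap₀ ξ f` satisfies `d(·)_z ∘ i = JX ∘ d(·)_z`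
(`crExpr_eq_zero_iff` and the transfer `isJHolomorphicAt_prodChart_comp_iff`).
[cite: Wendl2018, Thm. 2.46] -/
theorem isJHolomorphicAt_prodChart_vmap₀ (hιs : ContMDiff ((𝓡 2).prod 𝓘(ℝ, ℂ)) (𝓡 4) ∞ ι)
    (hιd : ∀ q, Injective (mfderiv ((𝓡 2).prod 𝓘(ℝ, ℂ)) (𝓡 4) ι q))
    (hint₀ : ∀ q v, mfderiv 𝓘(ℝ, ℂ × ℂ) (𝓡 4) (prodChart 0 ι) q (𝒥.J₀ q v) =
      JX (prodChart 0 ι q) (mfderiv 𝓘(ℝ, ℂ × ℂ) (𝓡 4) (prodChart 0 ι) q v))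
    {ξ f : ℂ → ℂ} {z : ℂ} (hv : DifferentiableAt ℝ (𝒥.vmap₀ ξ f) z)
    (hcr : crExpr 𝒥.J₀ (𝒥.vmap₀ ξ f) z = 0) (ζ : ℂ) :
    mfderiv 𝓘(ℝ, ℂ) (𝓡 4) (prodChart 0 ι ∘ 𝒥.vmap₀ ξ f) z (Complex.I * ζ) =
      JX ((prodChart 0 ι ∘ 𝒥.vmap₀ ξ f) z)
        (mfderiv 𝓘(ℝ, ℂ) (𝓡 4) (prodChart 0 ι ∘ 𝒥.vmap₀ ξ f) z ζ) :=
  (isJHolomorphicAt_prodChart_comp_iff JX 0 hιs hιd hv (hint₀ _)).2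
    ((crExpr_eq_zero_iff (fun x => 𝒥.sq₀ _ x)).1 hcr) ζ

/-- **The chart-`1` model is `JX`-holomorphic where the Cauchy–Riemann expression vanishes.**
[cite: Wendl2018, Thm. 2.46] -/
theorem isJHolomorphicAt_prodChart_vmap₁ (hιs : ContMDiff ((𝓡 2).prod 𝓘(ℝ, ℂ)) (𝓡 4) ∞ ι)
    (hιd : ∀ q, Injective (mfderiv ((𝓡 2).prod 𝓘(ℝ, ℂ)) (𝓡 4) ι q))
    (hint₁ : ∀ q v, mfderiv 𝓘(ℝ, ℂ × ℂ) (𝓡 4) (prodChart 1 ι) q (𝒥.J₁ q v) =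
      JX (prodChart 1 ι q) (mfderiv 𝓘(ℝ, ℂ × ℂ) (𝓡 4) (prodChart 1 ι) q v))
    {ξ f : ℂ → ℂ} {w : ℂ} (hv : DifferentiableAt ℝ (𝒥.vmap₁ ξ f) w)
    (hcr : crExpr 𝒥.J₁ (𝒥.vmap₁ ξ f) w = 0) (ζ : ℂ) :
    mfderiv 𝓘(ℝ, ℂ) (𝓡 4) (prodChart 1 ι ∘ 𝒥.vmap₁ ξ f) w (Complex.I * ζ) =
      JX ((prodChart 1 ι ∘ 𝒥.vmap₁ ξ f) w)
        (mfderiv 𝓘(ℝ, ℂ) (𝓡 4) (prodChart 1 ι ∘ 𝒥.vmap₁ ξ f) w ζ) :=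
  (isJHolomorphicAt_prodChart_comp_iff JX 1 hιs hιd hv (hint₁ _)).2
    ((crExpr_eq_zero_iff (fun x => 𝒥.sq₁ _ x)).1 hcr) ζ

omit [IsManifold (𝓡 4) ∞ X] in
/-- The chart models are differentiable where the chart maps are. [folklore] -/
theorem mdifferentiableAt_prodChart_comp (i : Fin 2)
    (hιs : ContMDiff ((𝓡 2).prod 𝓘(ℝ, ℂ)) (𝓡 4) ∞ ι) {v : ℂ → ℂ × ℂ} {z : ℂ}
    (hv : DifferentiableAt ℝ v z) :
    MDifferentiableAt 𝓘(ℝ, ℂ) (𝓡 4) (prodChart i ι ∘ v) z :=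
  ((contMDiff_prodChart i hιs _).mdifferentiableAt (by simp)).comp z hv.mdifferentiableAt

end JHolAt

/-! ### The leaves are `JX`-holomorphic and the family is jointly smooth -/

section Leaves

variable [IsManifold (𝓡 4) ∞ X] {JX : AlmostComplexStructure (𝓡 4) ∞ X}
  {ι : ComplexProjectiveSpace 1 × ℂ → X} {𝒥 : SphereACData} {ε : ℝ}
  {Ξ₀ Ξ₁ Φ₀ Φ₁ : ℂ → ℂ → ℂ} {U V : ℂ → ℂ → X}

/-- **Every leaf `U a`, `V a` (`|a| < ε`) of the glued family is `JX`-holomorphic**: on `|z| < 2`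
the leaf `U a` is the chart-`0` model and on `|z| > 2⁻¹` the chart-`1` model precomposed with the
inversion (symmetrically for `V a`); both models are `JX`-holomorphic on the discs of radius `2`
(`isJHolomorphicAt_prodChart_vmap₀`, `isJHolomorphicAt_prodChart_vmap₁`) and `J`-holomorphicity at
a point is invariant under the holomorphic inversion (`isJHolomorphicAt_comp_of_differentiableAt`).
[cite: Wendl2018, Thm. 2.46] -/
theorem isJHolomorphic_glueU_glueV
    (hιs : ContMDiff ((𝓡 2).prod 𝓘(ℝ, ℂ)) (𝓡 4) ∞ ι)
    (hιd : ∀ q, Injective (mfderiv ((𝓡 2).prod 𝓘(ℝ, ℂ)) (𝓡 4) ι q))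
    (hint₀ : ∀ q v, mfderiv 𝓘(ℝ, ℂ × ℂ) (𝓡 4) (prodChart 0 ι) q (𝒥.J₀ q v) =
      JX (prodChart 0 ι q) (mfderiv 𝓘(ℝ, ℂ × ℂ) (𝓡 4) (prodChart 0 ι) q v))
    (hint₁ : ∀ q v, mfderiv 𝓘(ℝ, ℂ × ℂ) (𝓡 4) (prodChart 1 ι) q (𝒥.J₁ q v) =
      JX (prodChart 1 ι q) (mfderiv 𝓘(ℝ, ℂ × ℂ) (𝓡 4) (prodChart 1 ι) q v))
    (hclutch : ∀ a : ℂ, ‖a‖ < ε → ∀ w : ℂ, w ≠ 0 →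
      Ξ₁ a w = -w ^ 2 * Ξ₀ a w⁻¹ ∧ Φ₁ a w = Φ₀ a w⁻¹)
    (hΞ₀s : ContDiffOn ℝ ∞ (fun q : ℂ × ℂ => Ξ₀ q.1 q.2) (Metric.ball 0 ε ×ˢ Set.univ))
    (hΞ₁s : ContDiffOn ℝ ∞ (fun q : ℂ × ℂ => Ξ₁ q.1 q.2) (Metric.ball 0 ε ×ˢ Set.univ))
    (hΦ₀s : ContDiffOn ℝ ∞ (fun q : ℂ × ℂ => Φ₀ q.1 q.2) (Metric.ball 0 ε ×ˢ Set.univ))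
    (hΦ₁s : ContDiffOn ℝ ∞ (fun q : ℂ × ℂ => Φ₁ q.1 q.2) (Metric.ball 0 ε ×ˢ Set.univ))
    (hcr : ∀ a : ℂ, ‖a‖ < ε →
      (∀ z : ℂ, ‖z‖ ≤ 2 → ‖Ξ₀ a z‖ < 2⁻¹ ∧ crExpr 𝒥.J₀ (𝒥.vmap₀ (Ξ₀ a) (Φ₀ a)) z = 0) ∧
      (∀ w : ℂ, ‖w‖ ≤ 2 → ‖Ξ₁ a w‖ < 2⁻¹ ∧ crExpr 𝒥.J₁ (𝒥.vmap₁ (Ξ₁ a) (Φ₁ a)) w = 0))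
    (hU : ∀ a z, U a z = if ‖z‖ < 2 then prodChart 0 ι (𝒥.vmap₀ (Ξ₀ a) (Φ₀ a) z)
      else prodChart 1 ι (𝒥.vmap₁ (Ξ₁ a) (Φ₁ a) z⁻¹))
    (hV : ∀ a w, V a w = if w = 0 then prodChart 1 ι (𝒥.vmap₁ (Ξ₁ a) (Φ₁ a) 0) else U a w⁻¹)
    {a : ℂ} (ha : ‖a‖ < ε) :
    IsJHolomorphic (𝓡 4) (fun y => JX y) (U a) ∧ IsJHolomorphic (𝓡 4) (fun y => JX y) (V a) := by
  have hΞ₀b : ∀ a : ℂ, ‖a‖ < ε → ∀ z : ℂ, ‖z‖ ≤ 2 → ‖Ξ₀ a z‖ < 2⁻¹ :=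
    fun a ha z hz => ((hcr a ha).1 z hz).1
  have hΞ₁b : ∀ a : ℂ, ‖a‖ < ε → ∀ w : ℂ, ‖w‖ ≤ 2 → ‖Ξ₁ a w‖ < 2⁻¹ :=
    fun a ha w hw => ((hcr a ha).2 w hw).1
  -- the two models on the closed discs of radius `2`
  have hm₀ : ∀ z : ℂ, ‖z‖ ≤ 2 → MDifferentiableAt 𝓘(ℝ, ℂ) (𝓡 4)
      (prodChart 0 ι ∘ 𝒥.vmap₀ (Ξ₀ a) (Φ₀ a)) z ∧ ∀ ζ : ℂ,
      mfderiv 𝓘(ℝ, ℂ) (𝓡 4) (prodChart 0 ι ∘ 𝒥.vmap₀ (Ξ₀ a) (Φ₀ a)) z (Complex.I * ζ) =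
        JX ((prodChart 0 ι ∘ 𝒥.vmap₀ (Ξ₀ a) (Φ₀ a)) z)
          (mfderiv 𝓘(ℝ, ℂ) (𝓡 4) (prodChart 0 ι ∘ 𝒥.vmap₀ (Ξ₀ a) (Φ₀ a)) z ζ) := fun z hz => by
    have hv := differentiableAt_vmap₀_family (𝒥 := 𝒥) hΞ₀s hΦ₀s hΞ₀b ha hz
    exact ⟨mdifferentiableAt_prodChart_comp 0 hιs hv,
      isJHolomorphicAt_prodChart_vmap₀ hιs hιd hint₀ hv ((hcr a ha).1 z hz).2⟩
  have hm₁ : ∀ w : ℂ, ‖w‖ ≤ 2 → MDifferentiableAt 𝓘(ℝ, ℂ) (𝓡 4)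
      (prodChart 1 ι ∘ 𝒥.vmap₁ (Ξ₁ a) (Φ₁ a)) w ∧ ∀ ζ : ℂ,
      mfderiv 𝓘(ℝ, ℂ) (𝓡 4) (prodChart 1 ι ∘ 𝒥.vmap₁ (Ξ₁ a) (Φ₁ a)) w (Complex.I * ζ) =
        JX ((prodChart 1 ι ∘ 𝒥.vmap₁ (Ξ₁ a) (Φ₁ a)) w)
          (mfderiv 𝓘(ℝ, ℂ) (𝓡 4) (prodChart 1 ι ∘ 𝒥.vmap₁ (Ξ₁ a) (Φ₁ a)) w ζ) := fun w hw => by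
    have hv := differentiableAt_vmap₁_family (𝒥 := 𝒥) hΞ₁s hΦ₁s hΞ₁b ha hw
    exact ⟨mdifferentiableAt_prodChart_comp 1 hιs hv,
      isJHolomorphicAt_prodChart_vmap₁ hιs hιd hint₁ hv ((hcr a ha).2 w hw).2⟩
  have hlt : IsOpen {z : ℂ | ‖z‖ < 2} := isOpen_lt continuous_norm continuous_const
  have hgt : IsOpen {z : ℂ | 2⁻¹ < ‖z‖} := isOpen_lt continuous_const continuous_norm
  refine ⟨fun z ζ => ?_, fun w ζ => ?_⟩
  · by_cases h2 : ‖z‖ < 2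
    · have hev : U a =ᶠ[𝓝 z] prodChart 0 ι ∘ 𝒥.vmap₀ (Ξ₀ a) (Φ₀ a) := by
        filter_upwards [hlt.mem_nhds h2] with z' hz'
        exact glueU_eq_chart₀ hU a hz'
      exact isJHolomorphicAt_congr_of_eventuallyEq hev (hm₀ z h2.le).2 ζ
    · obtain ⟨hz0, hhalf, hinv2⟩ := overlap_of_not_norm_lt_two h2
      have hev : U a =ᶠ[𝓝 z] (prodChart 1 ι ∘ 𝒥.vmap₁ (Ξ₁ a) (Φ₁ a)) ∘ fun w : ℂ => w⁻¹ := by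
        filter_upwards [hgt.mem_nhds hhalf] with z' hz'
        exact glueU_eq_chart₁ hclutch hΞ₀b hU ha hz'
      exact isJHolomorphicAt_congr_of_eventuallyEq hev
        (isJHolomorphicAt_comp_of_differentiableAt (g := fun w : ℂ => w⁻¹)
          (differentiableAt_inv hz0) (hm₁ z⁻¹ hinv2.le).1 (hm₁ z⁻¹ hinv2.le).2) ζ
  · by_cases h2 : ‖w‖ < 2
    · have hev : V a =ᶠ[𝓝 w] prodChart 1 ι ∘ 𝒥.vmap₁ (Ξ₁ a) (Φ₁ a) := by
        filter_upwards [hlt.mem_nhds h2] with w' hw'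
        exact glueV_eq_chart₁ hclutch hΞ₀b hU hV ha hw'
      exact isJHolomorphicAt_congr_of_eventuallyEq hev (hm₁ w h2.le).2 ζ
    · obtain ⟨hw0, hhalf, hinv2⟩ := overlap_of_not_norm_lt_two h2
      have hev : V a =ᶠ[𝓝 w] (prodChart 0 ι ∘ 𝒥.vmap₀ (Ξ₀ a) (Φ₀ a)) ∘ fun z : ℂ => z⁻¹ := by
        filter_upwards [hgt.mem_nhds hhalf] with w' hw'
        exact glueV_eq_chart₀ hU hV a hw'
      exact isJHolomorphicAt_congr_of_eventuallyEq hev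
        (isJHolomorphicAt_comp_of_differentiableAt (g := fun z : ℂ => z⁻¹)
          (differentiableAt_inv hw0) (hm₀ w⁻¹ hinv2.le).1 (hm₀ w⁻¹ hinv2.le).2) ζ

omit [IsManifold (𝓡 4) ∞ X] in
/-- **The glued families `U`, `V` are jointly `C^∞` on `B_ε × ℂ`**: near a point with `|z| < 2`,
`U` is the chart-`0` model (jointly `C^∞` on `B_ε × B_2`: `contDiffOn_vmap₀_family` composed with
the `C^∞` product chart), near a point with `|z| > 2⁻¹` the chart-`1` model precomposed with the
`C^∞` map `(a, z) ↦ (a, z⁻¹)`; symmetrically for `V`. [cite: Wendl2018, Thm. 2.46] -/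
theorem contMDiffOn_glueU_glueV
    (hιs : ContMDiff ((𝓡 2).prod 𝓘(ℝ, ℂ)) (𝓡 4) ∞ ι)
    (hclutch : ∀ a : ℂ, ‖a‖ < ε → ∀ w : ℂ, w ≠ 0 →
      Ξ₁ a w = -w ^ 2 * Ξ₀ a w⁻¹ ∧ Φ₁ a w = Φ₀ a w⁻¹)
    (hΞ₀s : ContDiffOn ℝ ∞ (fun q : ℂ × ℂ => Ξ₀ q.1 q.2) (Metric.ball 0 ε ×ˢ Set.univ))
    (hΞ₁s : ContDiffOn ℝ ∞ (fun q : ℂ × ℂ => Ξ₁ q.1 q.2) (Metric.ball 0 ε ×ˢ Set.univ))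
    (hΦ₀s : ContDiffOn ℝ ∞ (fun q : ℂ × ℂ => Φ₀ q.1 q.2) (Metric.ball 0 ε ×ˢ Set.univ))
    (hΦ₁s : ContDiffOn ℝ ∞ (fun q : ℂ × ℂ => Φ₁ q.1 q.2) (Metric.ball 0 ε ×ˢ Set.univ))
    (hΞ₀b : ∀ a : ℂ, ‖a‖ < ε → ∀ z : ℂ, ‖z‖ ≤ 2 → ‖Ξ₀ a z‖ < 2⁻¹)
    (hΞ₁b : ∀ a : ℂ, ‖a‖ < ε → ∀ w : ℂ, ‖w‖ ≤ 2 → ‖Ξ₁ a w‖ < 2⁻¹)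
    (hU : ∀ a z, U a z = if ‖z‖ < 2 then prodChart 0 ι (𝒥.vmap₀ (Ξ₀ a) (Φ₀ a) z)
      else prodChart 1 ι (𝒥.vmap₁ (Ξ₁ a) (Φ₁ a) z⁻¹))
    (hV : ∀ a w, V a w = if w = 0 then prodChart 1 ι (𝒥.vmap₁ (Ξ₁ a) (Φ₁ a) 0) else U a w⁻¹) :
    ContMDiffOn 𝓘(ℝ, ℂ × ℂ) (𝓡 4) ∞ (fun q : ℂ × ℂ => U q.1 q.2) (Metric.ball 0 ε ×ˢ univ) ∧
    ContMDiffOn 𝓘(ℝ, ℂ × ℂ) (𝓡 4) ∞ (fun q : ℂ × ℂ => V q.1 q.2) (Metric.ball 0 ε ×ˢ univ) := by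
  -- the two models, jointly `C^∞` on the open `B_ε × B_2`
  have hm₀ : ∀ q : ℂ × ℂ, ‖q.1‖ < ε → ‖q.2‖ < 2 → ContMDiffAt 𝓘(ℝ, ℂ × ℂ) (𝓡 4) ∞
      (fun q : ℂ × ℂ => prodChart 0 ι (𝒥.vmap₀ (Ξ₀ q.1) (Φ₀ q.1) q.2)) q := fun q ha hz =>
    ((contMDiff_prodChart 0 hιs).comp_contMDiffOn
      (contDiffOn_vmap₀_family hΞ₀s hΦ₀s hΞ₀b).contMDiffOn).contMDiffAt
        ((isOpen_ball_prod_ball ε).mem_nhds (mem_ball_prod_ball ha hz))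
  have hm₁ : ∀ q : ℂ × ℂ, ‖q.1‖ < ε → ‖q.2‖ < 2 → ContMDiffAt 𝓘(ℝ, ℂ × ℂ) (𝓡 4) ∞
      (fun q : ℂ × ℂ => prodChart 1 ι (𝒥.vmap₁ (Ξ₁ q.1) (Φ₁ q.1) q.2)) q := fun q ha hz =>
    ((contMDiff_prodChart 1 hιs).comp_contMDiffOn
      (contDiffOn_vmap₁_family hΞ₁s hΦ₁s hΞ₁b).contMDiffOn).contMDiffAt
        ((isOpen_ball_prod_ball ε).mem_nhds (mem_ball_prod_ball ha hz))
  -- the chart change `(a, z) ↦ (a, z⁻¹)` is `C^∞` off `{z = 0}`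
  have hψ : ∀ q : ℂ × ℂ, q.2 ≠ 0 →
      ContMDiffAt 𝓘(ℝ, ℂ × ℂ) 𝓘(ℝ, ℂ × ℂ) ∞ (fun q : ℂ × ℂ => (q.1, q.2⁻¹)) q := fun q hq =>
    (contDiffAt_fst.prodMk ((contDiffAt_inv ℝ hq).comp q contDiffAt_snd)).contMDiffAt
  refine ⟨fun q hq => ?_, fun q hq => ?_⟩ <;> have ha : ‖q.1‖ < ε := mem_ball_zero_iff.1 hq.1 <;>
    refine ContMDiffAt.contMDiffWithinAt ?_ <;> by_cases h2 : ‖q.2‖ < 2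
  · exact (hm₀ q ha h2).congr_of_eventuallyEq (glueU_eventuallyEq_chart₀ hU h2)
  · obtain ⟨hz0, hhalf, hinv2⟩ := overlap_of_not_norm_lt_two h2
    exact (ContMDiffAt.comp (f := fun q : ℂ × ℂ => (q.1, q.2⁻¹)) q (hm₁ (q.1, q.2⁻¹) ha hinv2)
      (hψ q hz0)).congr_of_eventuallyEq (glueU_eventuallyEq_chart₁ hclutch hΞ₀b hU ha hhalf)
  · exact (hm₁ q ha h2).congr_of_eventuallyEq (glueV_eventuallyEq_chart₁ hclutch hΞ₀b hU hV ha h2)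
  · obtain ⟨hz0, hhalf, hinv2⟩ := overlap_of_not_norm_lt_two h2
    exact (ContMDiffAt.comp (f := fun q : ℂ × ℂ => (q.1, q.2⁻¹)) q (hm₀ (q.1, q.2⁻¹) ha hinv2)
      (hψ q hz0)).congr_of_eventuallyEq (glueV_eventuallyEq_chart₀ hU hV hhalf)

end Leaves

/-! ### Effectiveness at the linearised normal level -/

section Effective

variable {ι : ComplexProjectiveSpace 1 × ℂ → X} {𝒥 : SphereACData} {ε : ℝ}
  {Ξ₀ Φ₀ : ℂ → ℂ → ℂ} {U : ℂ → ℂ → X}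

/-- **The glued family is effective at the linearised normal level.** Let `πN` be `C^∞` on the
open `N ⊇ range u₀`, vanishing on `range u₀`, with differential onto along it, and let `ι` be a
`C^∞` immersion `ℂℙ¹ × ℂ → X⁴` with `prodChart 0 ι (z, 0) = u₀ z`. For a family `U` with
`U a 0 = prodChart 0 ι (vmap₀ (Ξ₀ a) (Φ₀ a) 0) = prodChart 0 ι (Ξ₀ a 0, Qinv₀ 0 (Φ₀ a 0))`,
`Ξ₀ 0 0 = Φ₀ 0 0 = 0` and `Φ₀ a 0 = a` (`|a| < ε`), the derivative `d/da|₀ πN (U a 0)` is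
injective: `h = πN ∘ prodChart 0 ι : ℂ × ℂ → ℂ` has onto differential `L` at `(0, 0)`
(composition of the onto `dπN` with the bijective `d(prodChart 0 ι)`) which kills the axis
`ℂ × {0}` (`h = 0` there), so `t ↦ L (0, t)` is onto, hence one-to-one, and
`d/da|₀ πN (U a 0) c = L (0, Qinv₀ 0 c)` with `Qinv₀ 0` injective. [cite: Wendl2018, Thm. 2.46] -/
theorem fderiv_comp_glueU_zero_ne_zero {u₀ : ℂ → X} {N : Set X} {πN : X → ℂ}
    (hιs : ContMDiff ((𝓡 2).prod 𝓘(ℝ, ℂ)) (𝓡 4) ∞ ι)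
    (hιd : ∀ q, Injective (mfderiv ((𝓡 2).prod 𝓘(ℝ, ℂ)) (𝓡 4) ι q))
    (hax : ∀ z, prodChart 0 ι (z, 0) = u₀ z) (hN : IsOpen N) (hsub : range u₀ ⊆ N)
    (hπ : ContMDiffOn (𝓡 4) 𝓘(ℝ, ℂ) ∞ πN N)
    (hdπ : ∀ y ∈ N, Surjective (mfderiv (𝓡 4) 𝓘(ℝ, ℂ) πN y)) (hπ0 : ∀ z, πN (u₀ z) = 0)
    (hε : 0 < ε)
    (hΞ₀s : ContDiffOn ℝ ∞ (fun q : ℂ × ℂ => Ξ₀ q.1 q.2) (Metric.ball 0 ε ×ˢ Set.univ))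
    (h00 : Ξ₀ 0 0 = 0) (hΦ00 : Φ₀ 0 0 = 0) (hΦ₀0 : ∀ a : ℂ, ‖a‖ < ε → Φ₀ a 0 = a)
    (hU0 : ∀ a, U a 0 = prodChart 0 ι (𝒥.vmap₀ (Ξ₀ a) (Φ₀ a) 0)) {c : ℂ} (hc : c ≠ 0) :
    fderiv ℝ (fun a : ℂ => πN (U a 0)) 0 c ≠ 0 := by
  -- the flat map `h = πN ∘ prodChart 0 ι : ℂ × ℂ → ℂ` and its differential `L` at `(0, 0)`
  set h : ℂ × ℂ → ℂ := fun q => πN (prodChart 0 ι q) with hh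
  have hy : prodChart 0 ι (0, 0) ∈ N := by rw [hax]; exact hsub ⟨0, rfl⟩
  have hπd : MDifferentiableAt (𝓡 4) 𝓘(ℝ, ℂ) πN (prodChart 0 ι (0, 0)) :=
    (hπ.contMDiffAt (hN.mem_nhds hy)).mdifferentiableAt (by simp)
  have hPd : MDifferentiableAt 𝓘(ℝ, ℂ × ℂ) (𝓡 4) (prodChart 0 ι) (0, 0) :=
    (contMDiff_prodChart 0 hιs _).mdifferentiableAt (by simp)
  set L : ℂ × ℂ →L[ℝ] ℂ := (mfderiv (𝓡 4) 𝓘(ℝ, ℂ) πN (prodChart 0 ι (0, 0))).comp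
    (mfderiv 𝓘(ℝ, ℂ × ℂ) (𝓡 4) (prodChart 0 ι) (0, 0)) with hL
  have hhd : HasMFDerivAt 𝓘(ℝ, ℂ × ℂ) 𝓘(ℝ, ℂ) h (0, 0) L :=
    hπd.hasMFDerivAt.comp (0, 0) hPd.hasMFDerivAt
  have hhd' : HasFDerivAt h L (0, 0) := hasMFDerivAt_iff_hasFDerivAt.1 hhd
  -- `L` is onto
  have hPs : Surjective (mfderiv 𝓘(ℝ, ℂ × ℂ) (𝓡 4) (prodChart 0 ι) (0, 0)) :=
    (LinearMap.injective_iff_surjective_of_finrank_eq_finrank finrank_complex_prod).1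
      (injective_mfderiv_prodChart 0 hιs hιd _)
  have hLs : Surjective L := (hdπ _ hy).comp hPs
  -- `L` kills the axis: `h (Z, 0) = πN (u₀ Z) = 0`
  have hL0 : ∀ v : ℂ, L (v, 0) = 0 := by
    intro v
    have h1 : HasFDerivAt (fun Z : ℂ => ((Z, 0) : ℂ × ℂ)) (ContinuousLinearMap.inl ℝ ℂ ℂ) 0 :=
      (hasFDerivAt_id (𝕜 := ℝ) (0 : ℂ)).prodMk (hasFDerivAt_const (0 : ℂ) (0 : ℂ))
    have hg : HasFDerivAt (fun Z : ℂ => h (Z, 0)) (L.comp (ContinuousLinearMap.inl ℝ ℂ ℂ)) 0 :=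
      HasFDerivAt.comp (g := h) (f := fun Z : ℂ => ((Z, 0) : ℂ × ℂ)) 0 hhd' h1
    have hg0 : (fun Z : ℂ => h (Z, 0)) = fun _ => 0 := by
      funext Z
      show πN (prodChart 0 ι (Z, 0)) = 0
      rw [hax, hπ0]
    rw [hg0] at hg
    have h3 : L.comp (ContinuousLinearMap.inl ℝ ℂ ℂ) = 0 := by
      rw [← hg.fderiv, fderiv_const_apply]
    have h4 := DFunLike.congr_fun h3 v
    simpa using h4
  -- `t ↦ L (0, t)` is onto, hence one-to-one
  have hsplit : ∀ v t : ℂ, L (v, t) = L (v, 0) + L (0, t) := fun v t => by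
    rw [← map_add, Prod.mk_add_mk, add_zero, zero_add]
  set T : ℂ →L[ℝ] ℂ := L.comp (ContinuousLinearMap.inr ℝ ℂ ℂ) with hT
  have hTapply : ∀ t : ℂ, T t = L (0, t) := fun t => rfl
  have hTs : Surjective T := by
    intro s
    obtain ⟨⟨v, t⟩, hvt⟩ := hLs s
    refine ⟨t, ?_⟩
    rw [hTapply, ← hvt, hsplit v t, hL0, zero_add]
  have hTi : Injective T := by
    have h := (LinearMap.injective_iff_surjective (f := (T : ℂ →ₗ[ℝ] ℂ))).2 hTs
    exact h
  -- the curve `γ a = vmap₀ (Ξ₀ a) (Φ₀ a) 0 = (Ξ₀ a 0, Qinv₀ 0 a)` near `a = 0`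
  set γ : ℂ → ℂ × ℂ := fun a => 𝒥.vmap₀ (Ξ₀ a) (Φ₀ a) 0 with hγ
  have hγeq : (fun a : ℂ => πN (U a 0)) = h ∘ γ := by
    funext a
    show πN (U a 0) = πN (prodChart 0 ι (γ a))
    rw [hU0]
  have hγ0 : γ 0 = (0, 0) := by
    show (expChart 0 (Ξ₀ 0 0), 𝒥.Qinv₀ 0 (Φ₀ 0 0)) = (0, 0)
    rw [h00, hΦ00, expChart_zero, map_zero]
  have hΞd : DifferentiableAt ℝ (fun a : ℂ => Ξ₀ a 0) 0 :=
    (contDiffAt_slice_zero_left hΞ₀s hε).differentiableAt (by simp)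
  have hγ' : HasFDerivAt γ ((fderiv ℝ (fun a : ℂ => Ξ₀ a 0) 0).prod (𝒥.Qinv₀ 0)) 0 := by
    have h1 : HasFDerivAt (fun a : ℂ => (Ξ₀ a 0, 𝒥.Qinv₀ 0 a))
        ((fderiv ℝ (fun a : ℂ => Ξ₀ a 0) 0).prod (𝒥.Qinv₀ 0)) 0 :=
      hΞd.hasFDerivAt.prodMk (𝒥.Qinv₀ 0).hasFDerivAt
    refine h1.congr_of_eventuallyEq ?_
    filter_upwards [Metric.ball_mem_nhds (0 : ℂ) hε] with a ha
    show (expChart 0 (Ξ₀ a 0), 𝒥.Qinv₀ 0 (Φ₀ a 0)) = (Ξ₀ a 0, 𝒥.Qinv₀ 0 a)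
    rw [expChart_zero_left, hΦ₀0 a (mem_ball_zero_iff.1 ha)]
  -- chain rule and conclusion
  have hhd'' : HasFDerivAt h L (γ 0) := by rw [hγ0]; exact hhd'
  have hcomp : HasFDerivAt (h ∘ γ)
      (L.comp ((fderiv ℝ (fun a : ℂ => Ξ₀ a 0) 0).prod (𝒥.Qinv₀ 0))) 0 := hhd''.comp 0 hγ'
  rw [hγeq, hcomp.fderiv]
  intro habs
  have h1 : L (fderiv ℝ (fun a : ℂ => Ξ₀ a 0) 0 c, 𝒥.Qinv₀ 0 c) = 0 := habs
  rw [hsplit, hL0, zero_add, ← hTapply] at h1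
  have h2 : 𝒥.Qinv₀ 0 c = 0 := hTi (by rw [h1, map_zero])
  apply hc
  calc c = 𝒥.Q₀ 0 (𝒥.Qinv₀ 0 c) := (𝒥.Q₀_Qinv₀ 0 c).symm
    _ = 0 := by rw [h2, map_zero]

end Effective

end SphereCR

end Literature.Geometry.Symplectic

end
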